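import Mathlib
import HarnessLib
import HarnessLib.Audit
import Summits.ResolutionOfSingularities.Statement
import Summits.ResolutionOfSingularities.ResolutionOfSingularities.Theorems.WeightedInvariantTerminatingCentreDatum
import HarnessLib.Audit.Status.Attr

/-!
Route: WeightedInvariant

It suffices to show X = X1 ∧ X2 with X1 = WeightedThesis (target, typed; DERIVED inside the deciding
theorem since rev 14): for every prime p, every PERFECT field k of characteristic p and every
reduced separated k-scheme X of finite type, X has a resolution (a proper birational X~ -> X with X~
regular), and X2 = DescentPerfectToAll (crux rank 4, shared with route Descent): resolution over all
perfect fields of characteristic p implies ResolutionInChar p. The route's own content is HOW X1 is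
reached: through the interface WeightedResolutionDatum p
(Literature.AlgebraicGeometry.Resolution.WeightedResolutionDatum, landed 2026-08-15) — one
well-ordered value set Γ, an upper-semicontinuous invariant inv on every pair (Y smooth separated
finite type over perfect k, X ⊆ Y closed), functorial for smooth morphisms and perfect ground-field
extensions, minimal exactly where X is regular, whose maximum locus is a regular WEIGHTED centre and
which strictly drops on Wlodarczyk's cobordant blow-up B_+ of that centre — via the cruxes
WeightedConstruction (rank 2: ∀ p prime, Nonempty (WeightedResolutionDatum p)), its local germ form
LocalWeightedDrop (rank 3; enters through the globalization glue GlobalizeLocalDrop :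
LocalWeightedDrop → WeightedConstruction) and DatumToEmbedded (crux; ledger rank 3, the slot it held
as a support since 2026-08-13, tied with LocalWeightedDrop — in difficulty the most tractable of the
four, printed mathematics given the datum: a datum resolves every INTEGRAL closed subscheme of every
smooth separated quasi-compact Y over every perfect k of characteristic p — global cobordant tower,
torus quotient, tame destackification), and the derived support DatumToResolution (datum ⇒
WeightedThesis at p = DatumToEmbedded on the integral closed subschemes of the projective spaces
P^n_k + the landed projective reduction: irreducible components, Chow's lemma, projective closure).
Lean: `WeightedConstruction ∧ DatumToEmbedded ∧ DescentPerfectToAll` (deciding theorem `closes (hC :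
WeightedConstruction) (hE : DatumToEmbedded) (hD : DescentPerfectToAll) :
_root_.ResolutionOfSingularities`, rev 14: it derives `DatumToResolution` inside the proof — P^n_k →
Spec k smooth (isSmoothProjective_projectiveSpace_holds) and proper (isProper_projectiveSpace), then
Theorems/WeightedInvariantWeightedThesisProjectiveIntegralSuffices.stub_projectiveIntegralSuffices —
then `WeightedThesis := fun p hp => DatumToResolution p hp (WeightedConstruction p hp)`, then the
Statement prime by prime through DescentPerfectToAll; replaces rev 3's `closes (hT : WeightedThesis)
(hD : DescentPerfectToAll)`, whose cone carried no weighted content).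

Rationale: WHY THIS LINE. In characteristic 0 embedded resolution is now a one-line algorithm: blow up the
maximum locus of a single invariant along a WEIGHTED centre and the invariant drops, with no history
(AbramovichTemkinWlodarczyk2024 Thm 1.1.1; Wlodarczyk2022 = arXiv:2203.03090 Thms 1.1.4/1.1.6
recasts the weighted blow-up as the torus quotient of a smooth COBORDANT blow-up B_+, a scheme, so
no stacks are needed until the very end). Hironaka-style invariants fail in characteristic p for a
local reason — no hypersurface of maximal contact (Narasimhan), and the residual order of the
coefficient ideal can increase at kangaroo points (Moh1987; Hauser arXiv:0811.4151;
HauserPerlega2019) — but every recorded failure is a failure of SMOOTH centres read through maximal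
contact. The bet: in the larger move class of weighted/cobordant centres a history-free datum exists
in characteristic p although none exists with smooth centres (AbramovichQuekSchober2024 =
arXiv:2412.16426 do exactly this for plane curves and name the arbitrary-embedding-dimension case as
missing; AbramovichTemkinWlodarczyk2024 §1.9 poses it). Imported area: toric/torus-action geometry
(cobordant blow-ups, Cox-ring style Rees algebras) and tame-stack destackification (BerghRydh2019 =
arXiv:1905.00872, valid in characteristic p because the stabilisers μ_n ⊂ G_m are linearly
reductive). The interface is POSITED as a definition (WeightedResolutionDatum, with the refuter
checklist of stmt-0569 built in: transform pinned to B_+, guard on (iii)/(iv), perfect fields only)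
so that the negative literature becomes refutations of specific instances and the positive assembly
is provable independently of any construction.

RANKED CRUXES. #2 WeightedConstruction — ∀ p prime, Nonempty (WeightedResolutionDatum p) (why it
might fail: ATW's invariant uses iterated maximal contact + derivatives, both broken in char p; AQS
need MULTI-weighted centres already for plane curves when p | w; no candidate inv is known in dim ≥
3; sources AbramovichTemkinWlodarczyk2024, Wlodarczyk2022, AbramovichQuekSchober2024, Kollar2007).
#3 LocalWeightedDrop — the positional local game on formal hypersurface germs in growing embedding
dimension: one ordinal rank function that drops at every singular point of B_+ after some weighted
cobordant move (why it might fail: point-only strategies lose in dim ≥ 3, HauserPerlega2019 cycles;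
when p | w_i the germ on B_+ has no étale slice, AQS Rem 5.7/Ex 5.8; sources Wlodarczyk2022 Thm
4.3.1/Ex 4.5.1, AbramovichQuekSchober2024, HauserPerlega2019, Moh1987). #4 DescentPerfectToAll —
perfect fields ⇒ all fields of char p (why it might fail: regular is not geometrically regular under
inseparable extension, EGA IV 6.7.4; spreading out needs k/K0 separable, impossible beyond the
p-rank of k; sources Temkin2008 Q 3.3.3, CossartPiltant2009, Wlodarczyk2022 p.45,
Literature.Barriers.ResolutionOfSingularities.InseparableBaseChange). #3 (second item at ledger rank
3, kept from its support days; by difficulty it belongs after #4 — the most tractable crux, printed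
mathematics given the datum) DatumToEmbedded — Nonempty (WeightedResolutionDatum p) ⇒ every INTEGRAL
closed subscheme X of a smooth separated quasi-compact Y over a perfect field of characteristic p
has a resolution; leaf hypothesis of the deciding theorem since rev 14 (judge repair: the cone of
closes carries the weighted content), the imported area made explicit: well-founded induction on max
inv along the GLOBAL cobordant tower (termination: Theorems/WeightedInvariantTermination.lean; tower
end regular and T-invariant: P1, supports landed in
Theorems/WeightedInvariantDatumToEmbeddedRegular.lean, p85216), then the good quotient by the torus
G_m^m and the resolution of its tame abelian quotient singularities (why it might fail: X_m → X is
not proper before the quotient; good quotients + BerghRydh2019 Thm 2 destackification have no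
language in Mathlib and may close only modulo a named fact, i.e. a restated item; birationality
needs every centre inside the singular locus of the current strict transform; sources Wlodarczyk2022
Thm 1.1.6/2.3.9/§3.3.33, BerghRydh2019 Thm 2, AbramovichTemkinWlodarczyk2024 proof of Thm 1.1.1,
arXiv:2412.16426 Rem 5.6). Target: WeightedThesis (rank 0) — DERIVED inside closes as `fun p hp =>
DatumToResolution p hp (WeightedConstruction p hp)`; no longer a free hypothesis (ends the
2026-08-16 auto-crux). Supports: DatumToResolution (datum ⇒ WeightedThesis at p; DERIVED inside
closes from DatumToEmbedded applied to the integral closed subschemes of the projective spaces P^n_k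
— smooth, proper — and the landed projective reduction
Theorems/WeightedInvariantWeightedThesisProjectiveIntegralSuffices.lean = irreducible components +
ChowLemmaIntegral_holds + projective closure; provable outright the day DatumToEmbedded closes),
DescentReducedToIntegral (per-field, shared; proved), GlobalizeLocalDrop (LocalWeightedDrop →
WeightedConstruction: globalization of the local cobordant game into a datum — canonize the rank as
the game rank, extend beyond hypersurfaces, prove u.s.c./functoriality/descent; conjecture-grade
glue, unranked, not to be staffed before LocalWeightedDrop closes; it is the entrance of crux
LocalWeightedDrop into the leaf crux WeightedConstruction — closes keeps WeightedConstruction itself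
as the hypothesis so that a direct construction of the datum also decides the route).

KILL CRITERIA. ¬WeightedConstruction for some prime p proved from the definition as landed (e.g.
axioms (i)+(iii) jointly force a non-regular maximum locus on an explicit pair) closes the route
unless the refutation is an artefact of the interface (then: repaired definition + restated crux,
once). ¬LocalWeightedDrop (a germ family in char p on which EVERY weighted cobordant move has a
successor of no smaller rank for every ordinal rank function — e.g. a forced Hauser–Perlega-type
cycle surviving all weights) demotes the line to 'multi-weighted centres'
(AbramovichQuekSchober2024) or closes it. ¬DescentPerfectToAll does not kill X1 but confines the
route to perfect fields (then it no longer decides the summit: retire or convert to a conditional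
bridge). ¬DatumToEmbedded proved from the definition as landed (a datum whose cobordant tower cannot
be turned into a proper birational regular model — e.g. the axioms admit a datum whose centres leave
the singular locus, or whose tower has no good torus quotient) is an INTERFACE defect, not a defeat
of the line: repair WeightedResolutionDatum (add the missing consequence as an axiom) and restate
DatumToEmbedded + WeightedConstruction once; a second such refutation closes the route as mis-posed.
CossartPiltant-style dim ≤ 3 results elsewhere do not moot it.

NOT DECOMPOSED YET. The construction itself (which invariant: weighted order vectors vs
Rees-algebra/differential invariants of Benito–Bravo–Villamayor vs ridge/directrix data in small p);
calibration children of LocalWeightedDrop (n = 2 plane-curve start where AQS stop; Brieskorn–Pham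
germs, Wlodarczyk2022 Thm 4.2.2); the foreseen glued split of DatumToEmbedded (two layers, k = 2):
TowerRegular (datum ⇒ after finitely many GLOBAL cobordant steps the iterated strict transform is a
regular scheme with a G_m^m-action over X — P1, proved by prover-pitem-0572 up to landing) and
QuotientResolution (regular T-scheme with good quotient ⇒ HasResolution of the quotient's image:
good quotient by G_m^m + BerghRydh2019 Thm 2 tame destackification, the latter possibly as a named
Literature fact carried as an item), to be filed when the prover's P2 definitions (torus action,
good quotient) land — not before; functoriality beyond smooth morphisms (re-embedding principle) —
deliberately not an axiom, handled by Chow + integral components in DatumToResolution.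

CHEAPEST FALSIFIER. Run the char-2 kangaroo germ f = x² + y⁷ + yz⁴ (Hauser arXiv:0811.4151 p.3;
tree: Literature.Barriers.ResolutionOfSingularities.KangarooShadeIncrease,
Hauser2003_kangarooShadeIncrease) and the Hauser–Perlega e = 3 families (tree:
hauserPerlega_mohProofBoundFails) through ALL weighted cobordant moves of small weight and check
whether some natural rank (weighted order vector, then residual order on B_+) drops at every
exceptional point of B_+; a cycle that survives every weight ≤ 8 is strong evidence against
LocalWeightedDrop and hence against WeightedConstruction. Cost: a finite MvPolynomial computation
(kit), no theory.

Novelty: Searches (2026-08-15): lit search "weighted blow-up resolution singularities positive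
characteristic" (local 20 + crossref 20: AQS
2412.16426, ABQTW log-weighted 2503.13341, Wlodarczyk 2602.14266, ranking-functions 2602.06553, Quek
2022, Abramovich-Quek 2024
multi-weighted, Kawanoue-Matsuki RMI 2018); lit read arXiv:2203.03090 (pp. 2-5, 10-12, 36-37,
46-50), arXiv:2412.16426 (pp. 1-3,
10-12), arXiv:1905.00872 (pp. 3-4), arXiv:2602.06553 (pp. 2-3); lit galaxy search "resolution of
singularities in positive
characteristic" --star all (12 rows: Kawanoue-Matsuki IFP I/II, nothing new); lean search
(MvPowerSeries.subst/HasSubst, coeff, C, X);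
ledger negatives (0 refuted); idea list (about 90 cards; related: Kempf-vs-ATW weights,
ramified-coalescence-weights,
p-adic-equisingular-lifting, none routed here).
Nearest prior art found: arXiv:2203.03090 Thm 4.3.1 (one-step cobordant drop principle in arbitrary
characteristic, conditional on a
centre with (1)-(2); Ex. 4.5.1 Narasimhan in two steps) and arXiv:2412.16426 Thm 1.1/1.2 (plane
curves over perfect fields; the
authors state that the Artin-stack / B_+ route "would require a treatment in arbitrary embedding
dimension, which at present we do
not have" and switch to multi-weighted blow-ups); AbramovichTemkinWlodarczyk2024 §1.9 poses the
char-p question; arXiv:2602.06553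
searches ranking functions for SMOOTH-centre canonical blow-ups only.
Delta: the route turns ATW §1.9 / AQS's missing piece into a typed, history-free, positional sta  [refs: 2203.03090, 2412.16426, 1905.00872, 2602.06553, AbramovichTemkinWlodarczyk2024]

Barriers (technique_class: weighted/cobordant blow-ups; history-free invariant): - technique_class: weighted/cobordant blow-ups; history-free invariant
- Literature.Barriers.ResolutionOfSingularities.Hauser2003_kangarooShadeIncrease: kills invariants
whose 2nd entry is a residual order on a SMOOTH weak-maximal-contact hypersurface under
smooth-centre blow-ups; the cruxes quantify over WEIGHTED centres and arbitrary ordinal ranks, so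
the recorded increase is one losing strategy, not a counterexample — evaded in move class, not yet
in fact.
- Literature.Barriers.ResolutionOfSingularities.hauserPerlega_mohProofBoundFails: bites the
point-centre sub-strategy only (residual order → ∞ along point blow-ups, e = 3); the cheapest
falsifier runs these families through all small-weight cobordant moves.
- Literature.Barriers.ResolutionOfSingularities.Narasimhan1983_noSmoothHypersurfaceThroughTopLocus:
evaded — weighted/cobordant centres need no smooth hypersurface through the top locus;
arXiv:2203.03090 Ex 4.5.1 resolves that very germ by two cobordant blow-ups in char 2.
- Literature.Barriers.ResolutionOfSingularities.hironakaQuadric_directrixZero_and_nearPoint: bites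
only ranks built from the directrix in char 2 (directrix 0 while near points persist); the cruxes
prescribe no invariant; a prover using directrix data must pass to the ridge or to large p.
- Literature.Barriers.ResolutionOfSingularities.DirectrixSmallCharacteristicNarrow: not load-bearing
— no CJS Thm 3.14 near-point confinement is used (successors are ALL exceptional points of B_+).
- Literature.Barr

History (route lifecycle, newest last):
- 2026-08-15T16:32:21Z · rev 6: dropped EmbeddedToNonembedded — route-repair g2: drop EmbeddedToNonembedded (stmt-0573) from THIS route only (it stays wanted by UniformComplexity): its antecedent asks for embedded resolution (planner-rbadge-ResolutionOfSingularities-Weigh-7cf44994-g2-0)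
- 2026-08-16T04:16:13Z · AUTO-CRUX (backfill): WeightedThesis — hypotheses of the deciding theorem that nothing in the route derives are cruxes (operator:999:1085951)
- 2026-08-25T12:30:02Z · DORMANT — reconciler: no traction for 7.7 d (last activity item-evidence-added at 2026-08-17T19:14:32Z); parked, not closed — `ledger route dormant route-ResolutionOfSing (operator:999:3677749)
- 2026-08-26T16:25:45Z · REACTIVATED — dormant cleared (operator:999:1089860)

sub-problem: ResolutionOfSingularities · status: open · opened planner-ResolutionOfSingularities-Survey-0 2026-08-13T13:06:09Z · rev 21 · ledger route-ResolutionOfSingularities-WeightedInvariant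
GENERATED by the gate from the ledger (D-0016/17). Provers cite these decls: `theorem foo : Summit.ResolutionOfSingularities.ResolutionOfSingularities.Theses.WeightedInvariant.<Decl> := …` in Summits/ResolutionOfSingularities/ResolutionOfSingularities/Theorems/<Name>.lean.
-/

namespace Summit.ResolutionOfSingularities.ResolutionOfSingularities.Theses.WeightedInvariant

open scoped BigOperators Topology Manifold Classical MeasureTheory ProbabilityTheory Matrix InnerProductSpace ComplexConjugate ContinuousMap
open Filter Set Function TopologicalSpace MeasureTheory

attribute [summit_statement] _root_.ResolutionOfSingularities

/-- item stmt-ResolutionOfSingularities-19897 · crux · rank 3 · open · by planner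
why it might fail: = a winning strategy for the resolver in the GLOBAL weighted-cobordant game on hypersurface pairs; at wild points (p | w_i) every admissible centre may start an infinite tower (AQS Rem 5.7/Ex 5.8, Hauser–Perlega cycles); single-weight regular centres may not suffice (AQS: multi-weighted).
sources: Wlodarczyk2022 = arXiv:2203.03090 (Thm 1.1.4, 1.1.6, 2.1.10, §4), AbramovichTemkinWlodarczyk2024 (Thm 1.1.1, §1.9), AbramovichQuekSchober2024 = arXiv:2412.16426 (Rem 5.7, Ex 5.8), HauserPerlega2019, Summits/ResolutionOfSingularities/ResolutionOfSingularities/Cruxes/WeightedConstruction/STRATEGY-CENSUS.md §6, run/shared/lean/pub/res-hironaka/res-wc-repair-plan-1/RELAXATION-MENU.md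
[crux] RE-TYPED DOOR (replaces WeightedConstruction in `closes`; weakening certified by
HypersurfaceTerminatingCentreDatum.nonempty_of_nonempty_datum): for every prime p there is a
terminating weighted-centre datum on HYPERSURFACE pairs in characteristic p — for each (Y smooth
separated quasi-compact over a perfect k of char p, X ⊆ Y an integral hypersurface, not regular) a
regular weighted centre (Rees algebra) supported inside Sing X and homogeneous for every
X-preserving torus grading of every affine chart, plus a rank of pairs in a well-order that drops
from (Y, X) to the canonical successor (B_+ = global cobordant blow-up of the centre, strict
transform). No invariant, no semicontinuity, no functoriality for smooth morphisms / base change, no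
pointwise drop axiom: exactly the axioms the landed tower consumes. Candidate, never a fact.
[difficulty: open-problem] -/
@[route_item "route-ResolutionOfSingularities-WeightedInvariant", crux]
def HypersurfaceCentreConstruction : Prop :=
  ∀ p : ℕ, p.Prime → Nonempty (Summit.ResolutionOfSingularities.ResolutionOfSingularities.Theorems.HypersurfaceTerminatingCentreDatum p)

/-- item stmt-ResolutionOfSingularities-8899 · crux · rank 3 · open · by planner
why it might fail: Equivalent to winning the sliced cobordant game: tame points reduce to n-variable slices (p73411) but at WILD points (p | w_i) the successor is an honest (n+1)-germ; no rank known beyond surfaces; order-only ranks fail (x²+y³z²); N ≥ 4 residual W4/T″ not in print (embedded threefolds open).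
sources: Wlodarczyk2022 = arXiv:2203.03090 (Thm 4.3.1, Lemma 4.6.1), AbramovichQuekSchober2024 = arXiv:2412.16426 (Rem 5.7, Ex 5.8), HauserPerlega2019, paper:hauser2024-resolving-surface-singularities-positive-characteristic p.2, Summits/ResolutionOfSingularities/ResolutionOfSingularities/Cruxes/LocalWeightedDrop/
[crux] LOCAL COBORDANT GAME. Over an algebraically closed field k of char p there is ONE rank
function ι from formal hypersurface germs f in k[[x_1..x_n]] (all n) to the ordinals such that every
singular germ (f ≠ 0, f in m^2) admits a move — a formal coordinate change θ (zero constant terms,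
invertible linear part) and weights w in N^n with some w_i > 0, i.e. the weighted centre V(x_i : w_i
> 0) — after which EVERY singular germ g of the strict transform at a point of the exceptional
divisor of the full cobordant blow-up B = A^{n+1} (x_i = s^{w_i}(c_i + y_i) for w_i > 0, x_j = y_j
otherwise, c off the vertex, g = s-saturation of the transform, g(0) = 0, g in m^2) has ι(g) < ι(f).
Equivalently: a positional strategy of weighted cobordant blow-ups wins the local resolution game on
hypersurface germs in every embedding dimension (n grows by one per move, as on Wlodarczyk's B_+ /
the Artin-stack charts of AQS). [difficulty: open-problem] — why it might fail: Point-only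
strategies lose in dim >= 3 (HauserPerlega2019 cycles); when p | w_i the germ on B_+ has no etale
slice (AQS Rem 5.7/Ex 5.8) so successors are honest (n+1)-variable germs and no invariant in growing
embedding dimension -/
@[route_item "route-ResolutionOfSingularities-WeightedInvariant", crux]
def LocalWeightedDrop : Prop :=
  ∀ p : ℕ, p.Prime → ∀ (k : Type) [Field k] [CharP k p] [IsAlgClosed k], ∃ ι : (n : ℕ) → MvPowerSeries (Fin n) k → Ordinal.{0}, ∀ (n : ℕ) (f : MvPowerSeries (Fin n) k), (f ≠ 0 ∧ MvPowerSeries.constantCoeff f = 0 ∧ ∀ i, MvPowerSeries.coeff (Finsupp.single i 1) f = 0) → ∃ (θ : Fin n → MvPowerSeries (Fin n) k) (w : Fin n → ℕ), (∀ i, MvPowerSeries.constantCoeff (θ i) = 0) ∧ IsUnit (Matrix.det (Matrix.of fun i j => MvPowerSeries.coeff (Finsupp.single j 1) (θ i))) ∧ (∃ i, 0 < w i) ∧ ∀ (c : Fin n → k), (∃ i, 0 < w i ∧ c i ≠ 0) → ∀ (a : ℕ) (g : MvPowerSeries (Fin (n + 1)) k), MvPowerSeries.subst (fun i : Fin n =>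 if 0 < w i then MvPowerSeries.X (0 : Fin (n + 1)) ^ (w i) * (MvPowerSeries.C (c i) + MvPowerSeries.X i.succ) else MvPowerSeries.X i.succ) (MvPowerSeries.subst θ f) = MvPowerSeries.X (0 : Fin (n + 1)) ^ a * g → ¬ (MvPowerSeries.X (0 : Fin (n + 1)) ∣ g) → (MvPowerSeries.constantCoeff g = 0 ∧ ∀ j, MvPowerSeries.coeff (Finsupp.single j 1) g = 0) → ι (n + 1) g < ι n f

/-- item stmt-ResolutionOfSingularities-0549 · crux · rank 4 · open · by planner
why it might fail: Regular ≠ geometrically regular under inseparable k/K0 (EGA IV 6.7.4; Kollár 1.19, in tree); resolve-a-model-then-base-change needs k/K0 separable, impossible beyond the p-rank of k (k = F_p((t))); perfect closure + Frobenius back resolves only a TWIST of X (Liu 3.2.12); open for quadrics, char 2.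
sources: Temkin2008 = arXiv:math/0703678 (Question 3.3.3), CossartPiltant2009 = doi:10.1016/j.jalgebra.2008.11.030 (Main theorem: k differentially finite over a perfect field), Wlodarczyk2022 = arXiv:2203.03090 p.45, Kollar2007 (1.19), Literature.Barriers.ResolutionOfSingularities.InseparableBaseChange, Literature.Barriers.ResolutionOfSingularities.InseparableBaseChangeResolution
PerfectToAll: for a prime p, resolution of all reduced separated finite-type schemes over all
PERFECT fields of char p implies ResolutionInChar p (all fields of char p). Expected inputs:
Neron-Popescu (Stacks 07GC), spreading out, openness of regular locus on excellent schemes;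
regularity is not stable under inseparable ground field extension, which is the difficulty. -/
@[route_item "route-ResolutionOfSingularities-WeightedInvariant", crux]
def DescentPerfectToAll : Prop :=
  ∀ p : ℕ, p.Prime → (∀ (k : Type) [Field k] [CharP k p] [PerfectField k] (X : AlgebraicGeometry.Scheme.{0}) (f : X ⟶ AlgebraicGeometry.Spec (.of k)), AlgebraicGeometry.IsSeparated f → AlgebraicGeometry.LocallyOfFiniteType f → AlgebraicGeometry.QuasiCompact f → AlgebraicGeometry.IsReduced X → Literature.AlgebraicGeometry.Resolution.Scheme.HasResolution X) → Literature.AlgebraicGeometry.Resolution.ResolutionInChar.{0} p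

/-- item stmt-ResolutionOfSingularities-0569 · aside (kind.auto-crux: conjecture-grade) · rank 0 · open · by planner
why it might fail: It IS the resolution conjecture over perfect fields (open in dim ≥ 4 for every prime): one integral closed X ⊆ P^n_k, dim X ≥ 4, k perfect, without a resolution kills it (cdisprove v1.2); now DERIVED in closes from WeightedConstruction + DatumToEmbedded, no longer a free hypothesis.
sources: AbramovichTemkinWlodarczyk2024, Wlodarczyk2022, CossartPiltant2019, HauserPerlega2019, Literature.Barriers.ResolutionOfSingularities.DimensionFourFrontier, Summits/ResolutionOfSingularities/ResolutionOfSingularities/Cruxes/WeightedThesis/Disproof.lean (cdisprove v1.2)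
THESIS (informal until ResolutionDatum lands): for every prime p and n, a ResolutionDatum exists in
char p, dim n — well-ordered Γ_n; for each (Y regular separated finite-type over k of char p, dim Y
= n, X ⊆ Y closed) an u.s.c. inv : |Y| -> Γ_n compatible with smooth morphisms and ground-field
extension, minimal exactly on the resolved locus, whose maximum locus carries a canonical regular
(possibly weighted / Rees-algebra) centre whose blow-up (weighted blow-up + coarse space allowed)
strictly lowers max inv — AND embedded resolution of closed subschemes of regular quasi-projective
k-schemes implies ResolutionInChar p. -/
@[route_item "route-ResolutionOfSingularities-WeightedInvariant", crux]
def WeightedThesis : Prop :=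
  ∀ p : ℕ, p.Prime → ∀ (k : Type) [Field k] [CharP k p] [PerfectField k] (X : AlgebraicGeometry.Scheme.{0}) (f : X ⟶ AlgebraicGeometry.Spec (.of k)), AlgebraicGeometry.IsSeparated f → AlgebraicGeometry.LocallyOfFiniteType f → AlgebraicGeometry.QuasiCompact f → AlgebraicGeometry.IsReduced X → Literature.AlgebraicGeometry.Resolution.Scheme.HasResolution X

/-- item stmt-ResolutionOfSingularities-0571 · support · rank 2 · open · by planner
why it might fail: ATW's inv uses iterated maximal contact + derivatives, both gone in char p (Narasimhan; D(g^p)=0); AQS need MULTI-weighted centres for plane curves if p | w; axioms (iii) regular weighted max-locus + (iv) drop on B_+ may be jointly unsatisfiable at wild points (p | w_i); no candidate inv in dim ≥ 2.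
sources: AbramovichTemkinWlodarczyk2024 (Thm 1.1.1, §1.9), Wlodarczyk2022 = arXiv:2203.03090 (Thm 4.3.1, Ex 4.5.1, p.45), AbramovichQuekSchober2024 = arXiv:2412.16426 (Thm 1.1/1.2, Rem 5.7, Ex 5.8), Kollar2007, arXiv:0811.4151, Literature.Barriers.ResolutionOfSingularities.Narasimhan1983_noSmoothHypersurfaceThroughTopLocus
CONSTRUCTION (informal until ResolutionDatum lands): for every prime p and every n >= 4 there exists
a ResolutionDatum in characteristic p and dimension n (model: AbramovichTemkinWlodarczyk2024 Thm
1.1.1 in char 0, inv = (a_1..a_k) via iterated maximal contact, centre (x_1^{a_1},...,x_k^{a_k})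
weighted). Calibration to file first as a refutation instance: the char-0 datum (order of
coefficient ideal along a maximal-contact flag, smooth or weighted centres) violates axiom (iv) in
char p (Moh 1987 kangaroo/antelope points; Hauser2010). -/
@[route_item "route-ResolutionOfSingularities-WeightedInvariant", crux]
def WeightedConstruction : Prop :=
  ∀ p : ℕ, p.Prime → Nonempty (Literature.AlgebraicGeometry.Resolution.WeightedResolutionDatum p)

/-- item stmt-ResolutionOfSingularities-0572 · support · rank 3 · open · by planner
why it might fail: Tower end X_m is regular, T-invariant (P1 landed) but X_m → X is not proper: needs good quotients by G_m^m plus resolution of their tame abelian quotient singularities (BerghRydh2019 Thm 2; no torus actions/stacks in Mathlib, may close only modulo a named fact ⇒ restated item); centres ⊆ Sing too.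
sources: Wlodarczyk2022 = arXiv:2203.03090 (Thm 1.1.6, 2.3.9, §3.3.33), BerghRydh2019 = arXiv:1905.00872 (Thm 2), AbramovichTemkinWlodarczyk2024 (proof of Thm 1.1.1), arXiv:2412.16426 (Rem 5.6), Summits/ResolutionOfSingularities/ResolutionOfSingularities/Theorems/WeightedInvariantDatumToEmbeddedRegular.lean (P1 supports landed, p85216)
DATUM => EMBEDDED RESOLUTION (informal until ResolutionDatum lands): if a ResolutionDatum exists for
(p, n) then for every regular separated finite-type Y/k of dim n (char k = p) and closed X ⊆ Y there
is a finite sequence of the datum's blow-ups Y_m -> ... -> Y ending with (Y_m, X_m) resolved (strict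
transform X_m regular, proper and birational over X when X is integral and not contained in the
centre images). Proof shape: u.s.c. + Noetherian => finitely many values of inv; well-founded
induction on max inv in Γ_n. -/
@[route_item "route-ResolutionOfSingularities-WeightedInvariant", crux]
def DatumToEmbedded : Prop :=
  ∀ p : ℕ, p.Prime → Nonempty (Literature.AlgebraicGeometry.Resolution.WeightedResolutionDatum p) → ∀ (k : Type) [Field k] [CharP k p] [PerfectField k] (Y X : AlgebraicGeometry.Scheme.{0}) (f : Y ⟶ AlgebraicGeometry.Spec (.of k)) (i : X ⟶ Y), AlgebraicGeometry.Smooth f → AlgebraicGeometry.IsSeparated f → AlgebraicGeometry.QuasiCompact f → AlgebraicGeometry.IsClosedImmersion i → AlgebraicGeometry.IsIntegral X → Literature.AlgebraicGeometry.Resolution.Scheme.HasResolution X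

/-- item stmt-ResolutionOfSingularities-0551 · support · rank 5 · closed · proved by Summit.ResolutionOfSingularities.ResolutionOfSingularities.Theorems.descentReducedToIntegral_proof @ 607c4c5337b9 (prover) · by planner
sources: Literature.AlgebraicGeometry.Resolution.hasResolution_of_irreducibleComponents
ReducedToIntegral (fixed field k, any characteristic): if every integral separated finite-type
k-scheme has a resolution then every reduced separated finite-type k-scheme has one (resolve the
irreducible components with reduced structure and take the disjoint union; it is an isomorphism over
the dense open of points lying on exactly one component). Folklore. -/
@[route_item "route-ResolutionOfSingularities-WeightedInvariant"]
def DescentReducedToIntegral : Prop :=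
  ∀ (k : Type) [Field k], (∀ (X : AlgebraicGeometry.Scheme.{0}) (f : X ⟶ AlgebraicGeometry.Spec (.of k)), AlgebraicGeometry.IsSeparated f → AlgebraicGeometry.LocallyOfFiniteType f → AlgebraicGeometry.QuasiCompact f → AlgebraicGeometry.IsIntegral X → Literature.AlgebraicGeometry.Resolution.Scheme.HasResolution X) → ∀ (X : AlgebraicGeometry.Scheme.{0}) (f : X ⟶ AlgebraicGeometry.Spec (.of k)), AlgebraicGeometry.IsSeparated f → AlgebraicGeometry.LocallyOfFiniteType f → AlgebraicGeometry.QuasiCompact f → AlgebraicGeometry.IsReduced X → Literature.AlgebraicGeometry.Resolution.Scheme.HasResolution X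

-- `DescentReducedToIntegral` holds: proved by `Summit.ResolutionOfSingularities.ResolutionOfSingularities.Theorems.descentReducedToIntegral_proof` @ 607c4c5337b9 (its module imports this route file, so no `_holds` link can be stated here).

/-- item stmt-ResolutionOfSingularities-14763 · support · rank 9 · open · by planner
[support · glue, conjecture-grade] GLOBALIZATION OF THE LOCAL COBORDANT GAME (route-repair
2026-08-16, unused-crux: puts crux LocalWeightedDrop into the cone of the deciding theorem,
realising the chain LocalWeightedDrop ⇒ WeightedConstruction ⇒ DatumToResolution ⇒ WeightedThesis
stated in the route header). Claim: a positional winning strategy for the weighted cobordant blow-up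
game on formal hypersurface germs over algebraically closed fields of characteristic p
(LocalWeightedDrop) upgrades to a weighted resolution datum in characteristic p
(WeightedConstruction = ∀ p prime, Nonempty (WeightedResolutionDatum p)). Intended proof shape, none
of it in print in char p: (1) CANONIZE — replace the arbitrary rank ι by the game rank ρ(f) = least
ordinal admitting a move all of whose singular successors have smaller ρ (ρ is ordinal-valued on
every singular germ iff LocalWeightedDrop; it is invariant under formal automorphisms and units,
hence an invariant of the complete local ring k[[x]]/(f)); (2) EXTEND from principal ideals to
arbitrary closed subschemes X ⊆ Y (Y smooth) — or narrow the need to hypersurface pairs by finite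
birational projection of an integral projective X onto a hypers -/
@[route_item "route-ResolutionOfSingularities-WeightedInvariant", crux]
def GlobalizeLocalDrop : Prop :=
  LocalWeightedDrop → WeightedConstruction

/-- item stmt-ResolutionOfSingularities-19898 · support · rank 9 · open · by planner
why it might fail: Closes only modulo BerghRydh2019_diagonalizableQuotientResolution (tame destackification; no stacks in Mathlib) — same residue as today's DatumToEmbedded; BR over char-p fields is itself implied by the summit (BerghRydhCharP).
sources: BerghRydh2019 = arXiv:1905.00872 (Thm 2, Thm 5), Wlodarczyk2022 = arXiv:2203.03090 (Thm 1.1.6), Summits/ResolutionOfSingularities/ResolutionOfSingularities/Theorems/WeightedInvariantDatumToEmbedded.lean, run/shared/lean/pub/res-hironaka/res-wc-repair-plan-1/WeightedInvariantTerminatingCentreDatumConsumer.lean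
[support] RE-TYPED CONSUMER (replaces DatumToEmbedded/DatumToResolution in `closes`): a hypersurface
terminating centre datum in characteristic p resolves every reduced separated scheme of finite type
over every perfect field of characteristic p — Wlodarczyk's global cobordant tower run by rank
induction on hypersurface pairs (successor of a hypersurface pair is a hypersurface pair), torus
quotient + blow-up downstairs, Bergh–Rydh destackification at the regular end, then the landed
hypersurface reduction (HypersurfacesIff). PROVED modulo the named fact
BerghRydh2019_diagonalizableQuotientResolution in
WeightedInvariantTerminatingCentreDatumConsumer.lean
(hypersurfaceCentreToResolution_of_berghRydh2019, sorry-free, farm rc 0). [deps: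
HypersurfaceCentreConstruction] [difficulty: M modulo BR] -/
@[route_item "route-ResolutionOfSingularities-WeightedInvariant", crux]
def HypersurfaceCentreToResolution : Prop :=
  ∀ p : ℕ, p.Prime → Nonempty (Summit.ResolutionOfSingularities.ResolutionOfSingularities.Theorems.HypersurfaceTerminatingCentreDatum p) → ∀ (k : Type) [Field k] [CharP k p] [PerfectField k] (X : AlgebraicGeometry.Scheme.{0}) (f : X ⟶ AlgebraicGeometry.Spec (.of k)), AlgebraicGeometry.IsSeparated f → AlgebraicGeometry.LocallyOfFiniteType f → AlgebraicGeometry.QuasiCompact f → AlgebraicGeometry.IsReduced X → Literature.AlgebraicGeometry.Resolution.Scheme.HasResolution X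

/-- item stmt-ResolutionOfSingularities-8974 · support · rank 9 · open · by planner
sources: GortzWedhorn2020, Wlodarczyk2022
[support] DATUM ⇒ RESOLUTION OVER PERFECT FIELDS (layer-2 glue, informal until the definitions
CobordantBlowup / WeightedResolutionDatum land; replaces the intent of stmt-0572 'datum ⇒ embedded
resolution' after the 2026-08-15 route repair re-targeted the route to WeightedThesis = resolution
of reduced separated f.t. schemes over PERFECT fields): if a WeightedResolutionDatum exists in
characteristic p (crux WeightedConstruction, stmt-0571) then WeightedThesis holds at p. Proof shape:
(1) the u.s.c. invariant takes finitely many values on a Noetherian space and attains its maximum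
(ALREADY LANDED: Theorems/WeightedInvariantTermination.lean, finite_range_of_isClosed_superlevel /
exists_max_of_isClosed_superlevel); well-founded induction on max inv along the cobordant blow-ups
of the max loci gives a finite sequence Y = Y_0 <- B_{1,+} <- ... <- Y' with Y' smooth carrying a
torus action T and the strict transform X' smooth and T-invariant (Wlodarczyk arXiv:2203.03090 Thm
1.1.6 shape); (2) [Y'/T] is a smooth tame Artin stack with finite diagonalisable stabilisers, its
coarse space Y'/T -> Y is proper birational and has finite tame (abelian) quotient singularities;
(3) Bergh-Rydh arXiv:1 -/
@[route_item "route-ResolutionOfSingularities-WeightedInvariant", crux]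
def DatumToResolution : Prop :=
  ∀ p : ℕ, p.Prime → Nonempty (Literature.AlgebraicGeometry.Resolution.WeightedResolutionDatum p) → ∀ (k : Type) [Field k] [CharP k p] [PerfectField k] (X : AlgebraicGeometry.Scheme.{0}) (f : X ⟶ AlgebraicGeometry.Spec (.of k)), AlgebraicGeometry.IsSeparated f → AlgebraicGeometry.LocallyOfFiniteType f → AlgebraicGeometry.QuasiCompact f → AlgebraicGeometry.IsReduced X → Literature.AlgebraicGeometry.Resolution.Scheme.HasResolution X

/-- item stmt-ResolutionOfSingularities-0570 · assembly · rank 1 · closed · proved by Summit.ResolutionOfSingularities.ResolutionOfSingularities.Theorems.Assembly_proof @ cace366aebb1 (prover) · by planner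
ASSEMBLY (informal): existence of a ResolutionDatum for all (p, n) plus 'embedded => non-embedded'
(W4) implies the summit: datum => embedded resolution of (P^N_k, X) by well-founded induction (W3),
=> resolution of integral quasi-projective X, => all integral X by Chow (W4), => reduced X and all
fields via route Descent (D4, D3, D2) — or directly if the datum is defined over arbitrary k and X
reduced. -/
@[route_item "route-ResolutionOfSingularities-WeightedInvariant"]
def Assembly : Prop :=
  WeightedThesis → DescentPerfectToAll → _root_.ResolutionOfSingularities

-- `Assembly` holds: proved by `Summit.ResolutionOfSingularities.ResolutionOfSingularities.Theorems.Assembly_proof` @ cace366aebb1 (its module imports this route file, so no `_holds` link can be stated here).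

/-! D-0027 §2.1 — DECIDING THEOREM (planner-authored via `route open/edit --closes-file`; by planner-res-L1-w43-plan-1-g6-0 2026-08-27T02:44:45Z):
its hypotheses are this route's items and its conclusion the sub-problem Statement (glue_lint), and it elaborates with this file. -/

@[closes "route-ResolutionOfSingularities-WeightedInvariant"] theorem closes (hC : HypersurfaceCentreConstruction) (hE : HypersurfaceCentreToResolution) (hD : DescentPerfectToAll) :
    _root_.ResolutionOfSingularities := by
  -- derived target `WeightedThesis`: feed the door into the consumer, prime by prime
  have hT : WeightedThesis := fun p hp k _ _ _ X f hs hl hq hr => hE p hp (hC p hp) k X f hs hl hq hr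
  -- descent: perfect fields ⇒ all fields of characteristic `p`, prime by prime
  exact fun p hp => hD p hp (hT p hp)

end Summit.ResolutionOfSingularities.ResolutionOfSingularities.Theses.WeightedInvariant
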